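import Mathlib
import Literature.Computability.AlgebraicComplexity.FixedPointLog
import HarnessLib

/-!
# Format C, route K3 successor: kernel checker of a CELL-REFINED prime-shift certificate on a `k`-PRIME torus
# (offset walk, Kronecker-packed Gram columns)

Helper file (`--supports stmt-RiemannHypothesis-0098`, lead-track anchor; infrastructure for the Weil-positivity
window ladder, format C far bound `hPA`), RH-free.  Seat rh-explicit-weil-1 gen7 (memo
`run/shared/lean/pub/rh-explicit/rh-explicit-weil-1/FORMAT-K3.md` §8).

THE OBJECT (as `WeilFormatCCellShiftCert.lean`, route K3, but for ANY number of primes).  For primes `p_0, …, p_{k−1}`,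
a window `[−a, a]` split into `p` cells of width `2h = 2a/p` (`f_l = f·1_{cell l}`), and a Gram family indexed by
(monomial `S_β ∈ ℤ^k`, cell `l < p`) with INTEGER Gram vectors `c_{β,l} ∈ ℤ^r` (so `Q = (⟨c, c'⟩)/4^kbits ⪰ 0` by
construction), the transfer `0 ≤ ∫ Σ_i (Σ_{β,l} (c_{β,l,i}/2^kbits) f_l(x − S_β·ℓ))² dx`, `ℓ_j = log p_j`, regrouped by
the frequency `γ = S_β − S_β'` and the cell pair, gives for every real bounded measurable `f` vanishing off `[−aQ, aQ]`
`Σ_{(j,e) window} 2·(log p_j/√(p_j^e)) · I_f(e log p_j) ≤ D · ∫ f²`, `I_f(u) = ∫ f(x − u) f(x) dx = Σ_{l,l'} X(u,l,l')`,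
`X(u,l,l') = ∫ f_l(x − u) f_{l'}(x) dx` (`= 0` when `|u − 2h(l'−l)| ≥ 2h` — certified ADMISSIBLE classes — and
`|X| ≤ ∫ f²` always), with `D = g0 + Σ_{classes (γ,l,l') not admissible} |2·t(γ) + 2·m(γ,l,l')/4^kbits|`,
`g0 ≥` every diagonal cell mass.  Soundness: `WeilFormatCKCellSound.lean`.

THE CHECKER (pure first-order `ℕ/ℤ/ℚ/List` code for `decide +kernel`).  Two levers over the 4-prime pair pass:
* OFFSET WALK: the Gram data are BLOCKS `(S_β, [column of cell 0, …, column of cell p−1])`; for each offset `d ≥ 1`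
  ONE lock-step walk of `blocks.drop d` against `blocks` visits every unordered block pair once (`γ = S_{i+d} − S_i`),
  accumulating the `p × p` masses into a small per-offset class table (with blocks in lexicographic order every `γ`
  occurs at a single offset; soundness does NOT depend on the order).  Window items carry a HINT offset `woff`
  (any `1 ≤ woff < #blocks` is sound).  Parts = offsets `d ≡ j (mod nparts)`.
* KRONECKER-PACKED COLUMNS (`Literature/Analysis/ValidatedNumerics/KroneckerDotProduct.lean`): each Gram column is
  stored as `A` = `packN W` of the digits `c_i + moff` (the checker derives ONCE `B = packRevN W r` of the digits and the digit sum `s`); the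
  mass of a column pair is ONE `A·B' / W^{r−1} % W` (= `KroneckerDot.kdotN`) — three GMP operations instead of `r`
  kernel multiplications (measured: 19 900 column pairs of rank 31 in < 2 s vs 25 s for 4 950 pairs with `Int` dot
  products); `check` validates the digits of `A` against the cap `dmax` and `r·dmax² < W`. -/

set_option linter.dupNamespace false
set_option autoImplicit false
namespace Summit.RiemannHypothesis.RiemannHypothesis.Theorems.WeilFormatC

namespace KCell

/-- A window item `(j, e, s, d)`: the prime power `p_j^e`, its CLAIMED `s = ⌊2^P √(p_j^e)⌋`, and the HINT offset `d`
at which its class is accounted. [folklore] -/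
abbrev WItem := ℕ × ℕ × ℕ × ℕ

/-- A packed Gram column `(A, B, s)`: `A = packN W digits`, `B = packRevN W r digits`, `s = Σ digits`
(digits `= c_i + moff ∈ [0, dmax]`). [folklore] -/
abbrev PCol := ℕ × ℕ × ℕ

/-- A Gram block: monomial exponent vector `S_β ∈ ℤ^k` and its `p` packed columns (one per cell). [folklore] -/
abbrev Block := List ℤ × List PCol

/-- Accumulated masses of a class and a cell pair: `(U, V, cnt)` with `Σ ⟨c, c'⟩ = U + cnt·r·moff² − moff·V`
(`U = Σ kdot`, `V = Σ (s + s')`). [folklore] -/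
abbrev Mass := ℕ × ℕ × ℕ

/-- A class-table entry: frequency vector `γ`, `p × p` mass matrix (row = cell of the LATER block's column,
column = cell of the EARLIER block's column), attached window items. [folklore] -/
abbrev Entry := List ℤ × List (List Mass) × List WItem

/-- **The certificate data.** [folklore] -/
structure Cert where
  /-- the primes (torus coordinates) -/
  primes : List ℕ
  /-- range hints `2^{e_j} ≤ p_j ≤ 2^{e_j+1}` (checked) -/
  hints : List ℕ
  /-- CLAIMED lower enclosures `⌊2^P log p_j⌋` (checked against `FixedPoint.logNatLo`) -/
  llo : List ℕ
  /-- CLAIMED upper enclosures of `2^P log p_j` (checked against `FixedPoint.logNatHi`) -/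
  lhi : List ℕ
  /-- fixed-point precision `P` (bits) of the logarithm enclosures -/
  prec : ℕ
  /-- number of series terms `K` of the logarithm enclosures -/
  terms : ℕ
  /-- window items `(j, e)`: the prime power `p_j^e` -/
  window : List (ℕ × ℕ)
  /-- CLAIMED `⌊2^P √(p_j^e)⌋` for each window item, same order (checked by squaring) -/
  wsq : List ℕ
  /-- HINT offset of each window item, same order (checked: `1 ≤ d < #blocks`) -/
  woff : List ℕ
  /-- number of cells `p ≥ 1` (cell width `2·aQ/p`) -/
  pcells : ℕ
  /-- scaling: `Q = (⟨c, c'⟩)/4^kbits` -/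
  kbits : ℕ
  /-- digit offset: stored digits are `c_i + moff` -/
  moff : ℕ
  /-- digit cap (checked for every digit; `rank·dmax² < W` checked) -/
  dmax : ℕ
  /-- slot base of the Kronecker packing -/
  W : ℕ
  /-- CLAIMED `W^(rank−1)` (checked) -/
  Wr1 : ℕ
  /-- the common length `r` of the Gram vectors -/
  rank : ℕ
  /-- the RAW Gram blocks `(S_β, [A_0, …, A_{p−1}])`: monomial and the Kronecker-packed column of each cell
  (`A_l = packN W (digits c_{β,l} + moff)`); `Cert.blocks` derives `(A, B, s)` per column -/
  rblocks : List (List ℤ × List ℕ)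
  /-- validity: the window half-width `aQ` (the bound then holds for every `a ≤ aQ`) -/
  aQ : ℚ
  /-- CLAIMED integer threshold `2^{P+1} · num(aQ)` (checked) -/
  thr : ℤ
  /-- CLAIMED denominator of `aQ` (checked) -/
  aden : ℤ
  /-- number of parts (part `j` = the offsets `d ≡ j mod nparts`) -/
  nparts : ℕ
  /-- CLAIMED bound of the classes of each part -/
  dparts : List ℚ
  /-- CLAIMED bound of every diagonal cell mass `/4^kbits` -/
  g0 : ℚ
  /-- the claimed constant (`g0 + Σ dparts ≤ D`, checked) -/
  D : ℚ

namespace Cert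

variable (c : Cert)

/-! ### Header: primes, enclosures, window items -/

/-- `j`-th prime (`0` beyond the list). [folklore] -/
def pj (j : ℕ) : ℕ := c.primes.getD j 0
/-- `j`-th range hint. [folklore] -/
def ej (j : ℕ) : ℕ := c.hints.getD j 0
/-- claimed lower enclosure of `2^P log p_j`. [folklore] -/
def logLo (j : ℕ) : ℕ := c.llo.getD j 0
/-- claimed upper enclosure of `2^P log p_j`. [folklore] -/
def logHi (j : ℕ) : ℕ := c.lhi.getD j 0

/-- Per-prime header check from position `j` on: range hint, and the claimed enclosures ARE the tree's
`FixedPoint.logNatLo/Hi P K e_j p_j`. [folklore] -/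
def hdrOK (j : ℕ) : List ℕ → Bool
  | [] => true
  | q :: qs =>
      Literature.Computability.AlgebraicComplexity.FixedPoint.inRange (c.ej j) q &&
      decide (c.logLo j = Literature.Computability.AlgebraicComplexity.FixedPoint.logNatLo c.prec c.terms (c.ej j) q) &&
      decide (c.logHi j = Literature.Computability.AlgebraicComplexity.FixedPoint.logNatHi c.prec c.terms (c.ej j) q) &&
      hdrOK (j + 1) qs

/-- All header checks: list lengths, per-prime checks, the integer form of `aQ`. [folklore] -/
def logsOK : Bool :=
  decide (c.hints.length = c.primes.length) && decide (c.llo.length = c.primes.length) &&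
    decide (c.lhi.length = c.primes.length) && c.hdrOK 0 c.primes &&
    decide (c.thr = 2 ^ (c.prec + 1) * c.aQ.num) && decide (c.aden = (c.aQ.den : ℤ))

/-- lower enclosure of `2^P · x · log p_j`. [folklore] -/
def mulLogLo (j : ℕ) (x : ℤ) : ℤ := if 0 ≤ x then x * (c.logLo j : ℤ) else x * (c.logHi j : ℤ)

/-- upper enclosure of `2^P · x · log p_j`. [folklore] -/
def mulLogHi (j : ℕ) (x : ℤ) : ℤ := if 0 ≤ x then x * (c.logHi j : ℤ) else x * (c.logLo j : ℤ)

/-- lower enclosure of `2^P · γ·ℓ` (coordinates from position `j`). [folklore] -/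
def freqLoFrom (j : ℕ) : List ℤ → ℤ
  | [] => 0
  | x :: xs => c.mulLogLo j x + freqLoFrom (j + 1) xs

/-- upper enclosure of `2^P · γ·ℓ` (coordinates from position `j`). [folklore] -/
def freqHiFrom (j : ℕ) : List ℤ → ℤ
  | [] => 0
  | x :: xs => c.mulLogHi j x + freqHiFrom (j + 1) xs

/-- lower enclosure of `2^P · γ·ℓ`. [folklore] -/
def freqLo (γ : List ℤ) : ℤ := c.freqLoFrom 0 γ
/-- upper enclosure of `2^P · γ·ℓ`. [folklore] -/
def freqHi (γ : List ℤ) : ℤ := c.freqHiFrom 0 γ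

/-- The ADMISSIBILITY test of the class `(γ, k, l)` given the enclosures `lo ≤ 2^P γ·ℓ ≤ hi`: certified
`γ·ℓ > 2h(l−k+1)` or `γ·ℓ < 2h(l−k−1)`, `2h = 2aQ/p` (integer form). [folklore] -/
def admLH (lo hi : ℤ) (k l : ℕ) : Bool :=
  decide (c.thr * ((l : ℤ) - k + 1) < lo * c.aden * c.pcells) ||
  decide (hi * c.aden * c.pcells < c.thr * ((l : ℤ) - k - 1))

/-- Admissibility of `(γ, k, l)`. [folklore] -/
def adm (γ : List ℤ) (k l : ℕ) : Bool := c.admLH (c.freqLo γ) (c.freqHi γ) k l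

/-- zip of the window items with their claimed square roots and hint offsets. [folklore] -/
def zipW : List (ℕ × ℕ) → List ℕ → List ℕ → List WItem
  | w :: ws, s :: ss, d :: ds => (w.1, w.2, s, d) :: zipW ws ss ds
  | _, _, _ => []

/-- The window items `(j, e, s, d)`. [folklore] -/
def witems : List WItem := zipW c.window c.wsq c.woff

/-- lower bracket of the weight `log p_j / √(p_j^e)` (`s = ⌊2^P √(p_j^e)⌋`). [folklore] -/
def wLo (w : WItem) : ℚ := (c.logLo w.1 : ℚ) / ((w.2.2.1 : ℚ) + 1)
/-- upper bracket of the weight `log p_j / √(p_j^e)`. [folklore] -/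
def wHi (w : WItem) : ℚ := (c.logHi w.1 : ℚ) / (w.2.2.1 : ℚ)

/-- A window item is well formed: `j < k`, `1 ≤ e`, `s` IS `⌊2^P √(p_j^e)⌋` with `0 < s`, `1 ≤ d < #blocks`. -/
def witemOK (w : WItem) : Bool :=
  decide (w.1 < c.primes.length) && decide (1 ≤ w.2.1) && decide (0 < w.2.2.1) &&
    decide (w.2.2.1 ^ 2 ≤ c.pj w.1 ^ w.2.1 * 4 ^ c.prec) && decide (c.pj w.1 ^ w.2.1 * 4 ^ c.prec < (w.2.2.1 + 1) ^ 2) &&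
    decide (1 ≤ w.2.2.2) && decide (w.2.2.2 < c.rblocks.length)

/-- All window items well formed. -/
def windowOK : List WItem → Bool
  | [] => true
  | w :: rest => c.witemOK w && windowOK rest

/-- Sum of lower weight brackets. -/
def wLoSum : List WItem → ℚ
  | [] => 0
  | w :: ws => c.wLo w + wLoSum ws

/-- Sum of upper weight brackets. -/
def wHiSum : List WItem → ℚ
  | [] => 0
  | w :: ws => c.wHi w + wHiSum ws

/-- `e · unit(j)` of length `n`. [folklore] -/
def uvecN (j : ℕ) (e : ℤ) : ℕ → List ℤ
  | 0 => []
  | n + 1 => (if j = 0 then e else 0) :: uvecN (j - 1) (if j = 0 then 0 else e) n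

/-- `e · unit(j) ∈ ℤ^k`. [folklore] -/
def uvec (j : ℕ) (e : ℤ) : List ℤ := uvecN j e c.primes.length

/-! ### Packed columns -/

/-- `packRevN W n [b₀, b₁, …] = Σ_k b_k W^(n−1−k)` — verbatim copy of `KroneckerDot.packRevN`
(`Literature/Analysis/ValidatedNumerics/KroneckerDotProduct.lean`; identified in the soundness file). [folklore] -/
def packRevN (W : ℕ) : ℕ → List ℕ → ℕ
  | _, [] => 0
  | n, b :: bs => b * W ^ (n - 1) + packRevN W (n - 1) bs

/-- Sum of a list of naturals — verbatim copy of `KroneckerDot.sumN`. [folklore] -/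
def sumN : List ℕ → ℕ
  | [] => 0
  | a :: as => a + sumN as

/-- base-`W` digits of `A`, `r` of them (least significant first). [folklore] -/
def digits (W : ℕ) : ℕ → ℕ → List ℕ
  | 0, _ => []
  | r + 1, A => A % W :: digits W r (A / W)

/-- every entry `≤ M`. -/
def allLe (M : ℕ) : List ℕ → Bool
  | [] => true
  | x :: xs => decide (x ≤ M) && allLe M xs

/-- The derived packed column of a raw `A`: `(A, packRevN W r (digits A), Σ digits)`. [folklore] -/
def prepCol (A : ℕ) : PCol := (A, packRevN c.W c.rank (digits c.W c.rank A), sumN (digits c.W c.rank A))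

/-- Derived columns of a raw column list. -/
def prepCols : List ℕ → List PCol
  | [] => []
  | A :: As => c.prepCol A :: prepCols As

/-- Derived blocks of a raw block list. -/
def prepBlocks : List (List ℤ × List ℕ) → List Block
  | [] => []
  | b :: bs => (b.1, c.prepCols b.2) :: prepBlocks bs

/-- **The Gram blocks** `(S_β, [(A, B, s) per cell])`, derived once from the raw data. [folklore] -/
def blocks : List Block := c.prepBlocks c.rblocks

/-- A packed column is consistent: `A < W^r`, `B = packRevN W r (digits A)`, `s = Σ digits`, digits `≤ dmax`. -/
def colOK (q : PCol) : Bool :=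
  decide (q.1 < c.W ^ c.rank) &&
    decide (q.2.1 = packRevN c.W c.rank (digits c.W c.rank q.1)) &&
    decide (q.2.2 = sumN (digits c.W c.rank q.1)) && allLe c.dmax (digits c.W c.rank q.1)

/-- all columns of a block consistent. -/
def colsOK : List PCol → Bool
  | [] => true
  | q :: qs => c.colOK q && colsOK qs

/-- every block: `|S| = k`, exactly `p` columns, all consistent. -/
def blocksOK : List Block → Bool
  | [] => true
  | b :: bs => decide (b.1.length = c.primes.length) && decide (b.2.length = c.pcells) && c.colsOK b.2 && blocksOK bs

/-- The Kronecker dot product of a later column `A` with an earlier column `B`: digit `r − 1` of `A·B`. [folklore] -/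
def kdot (A B : ℕ) : ℕ := A * B / c.Wr1 % c.W

/-- column `k` of a block's column list (zero column beyond). -/
def col (qs : List PCol) (k : ℕ) : PCol := qs.getD k (0, 0, 0)

/-! ### Class tables -/

/-- entry `(k, l)` of a mass matrix (zero beyond). [folklore] -/
def mget (M : List (List Mass)) (k l : ℕ) : Mass := (M.getD k []).getD l (0, 0, 0)

/-- componentwise sum of two masses. -/
def madd1 (x y : Mass) : Mass := (x.1 + y.1, x.2.1 + y.2.1, x.2.2 + y.2.2)

/-- sum of two `p × p` mass matrices. [folklore] -/
def madd (M M' : List (List Mass)) : List (List Mass) :=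
  (List.range c.pcells).map fun k ↦ (List.range c.pcells).map fun l ↦ madd1 (mget M k l) (mget M' k l)

/-- the `p × p` masses of a block pair: row `k` = cell of the LATER block, column `l` = cell of the EARLIER one. -/
def mmat (later earlier : List PCol) : List (List Mass) :=
  (List.range c.pcells).map fun k ↦ (List.range c.pcells).map fun l ↦
    (c.kdot (col later k).1 (col earlier l).2.1, (col later k).2.2 + (col earlier l).2.2, 1)

/-- the zero mass matrix. -/
def zmat : List (List Mass) := (List.range c.pcells).map fun _ ↦ (List.range c.pcells).map fun _ ↦ (0, 0, 0)

/-- componentwise difference of exponent vectors. [folklore] -/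
def vsub : List ℤ → List ℤ → List ℤ
  | x :: xs, y :: ys => (x - y) :: vsub xs ys
  | _, _ => []

/-- Accumulate `(γ, M, ws)` into a class table (linear search on `γ`). [folklore] -/
def ins (γ : List ℤ) (M : List (List Mass)) (ws : List WItem) : List Entry → List Entry
  | [] => [(γ, M, ws)]
  | (γ', M', ws') :: rest =>
      if γ = γ' then (γ', c.madd M' M, ws ++ ws') :: rest else (γ', M', ws') :: ins γ M ws rest

/-- The lock-step walk of the later blocks against the earlier ones (the `match` forces the accumulator). -/
def walk : List Block → List Block → List Entry → List Entry
  | bL :: ls, bE :: es, acc =>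
      match c.ins (vsub bL.1 bE.1) (c.mmat bL.2 bE.2) [] acc with
      | [] => walk ls es []
      | en :: ens => walk ls es (en :: ens)
  | _, _, acc => acc

/-- Window entries hinted at offset `d`. -/
def windowEntriesAt (d : ℕ) : List WItem → List Entry → List Entry
  | [], acc => acc
  | w :: rest, acc => windowEntriesAt d rest (if w.2.2.2 = d then c.ins (c.uvec w.1 w.2.1) c.zmat [w] acc else acc)

/-- The class table of offset `d`. [folklore] -/
def tableD (d : ℕ) : List Entry := c.walk (c.blocks.drop d) c.blocks (c.windowEntriesAt d c.witems [])

/-- The integer Gram mass of an accumulated `(U, V, cnt)`: `U + cnt·r·moff² − moff·V`. [folklore] -/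
def mass (t : Mass) : ℤ := ((t.1 + t.2.2 * c.rank * c.moff * c.moff : ℕ) : ℤ) - ((c.moff * t.2.1 : ℕ) : ℤ)

/-- structural sum of rationals over the cells `l < p` of a row function. -/
def rowSum (F : ℕ → ℚ) : List ℕ → ℚ
  | [] => 0
  | l :: ls => F l + rowSum F ls

/-- The certified bound of one entry: `Σ_{k,l<p, ¬adm} max |2·wLo-sum + 2m/4^kbits| |2·wHi-sum + 2m/4^kbits|`. [folklore] -/
def entryBound (en : Entry) : ℚ :=
  rowSum (fun k ↦ rowSum (fun l ↦
      if c.admLH (c.freqLo en.1) (c.freqHi en.1) k l then 0 else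
        max |2 * c.wLoSum en.2.2 + 2 * (c.mass (mget en.2.1 k l) : ℚ) / (4 : ℚ) ^ c.kbits|
          |2 * c.wHiSum en.2.2 + 2 * (c.mass (mget en.2.1 k l) : ℚ) / (4 : ℚ) ^ c.kbits|)
      (List.range c.pcells)) (List.range c.pcells)

/-- Every attached window item is well formed. -/
def attachedOK : List WItem → Bool
  | [] => true
  | w :: ws => c.witemOK w && attachedOK ws

/-- One pass over a table: attached items well formed, accumulated bound. -/
def tableAcc : List Entry → ℚ → Option ℚ
  | [], acc => some acc
  | en :: rest, acc => if c.attachedOK en.2.2 then tableAcc rest (acc + c.entryBound en) else none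

/-- Accumulate the table bounds of the offsets `d, d−1, …, 1` that belong to part `j`. -/
def partAcc (j : ℕ) : ℕ → ℚ → Option ℚ
  | 0, acc => some acc
  | d + 1, acc =>
      if (d + 1) % c.nparts = j then
        match c.tableAcc (c.tableD (d + 1)) acc with
        | none => none
        | some acc' => partAcc j d acc'
      else partAcc j d acc

/-- **Part check** (one kernel file per part or group of parts): the classes at the offsets `d ≡ j (mod nparts)`,
`1 ≤ d < #blocks`, are bounded by the claimed `dparts[j]`. [folklore] -/
def checkPart (j : ℕ) : Bool :=
  match c.partAcc j (c.rblocks.length - 1) 0 with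
  | none => false
  | some q => decide (q ≤ c.dparts.getD j 0)

/-- The diagonal Gram mass of cell `k`: `Σ_β |c_{β,k}|²` (as an integer). [folklore] -/
def massOf (k : ℕ) : List Block → ℤ
  | [] => 0
  | b :: bs => c.mass (c.kdot (col b.2 k).1 (col b.2 k).2.1, 2 * (col b.2 k).2.2, 1) + massOf k bs

/-- Every cell's diagonal mass is `≤ g0 · 4^kbits`. -/
def massOK : List ℕ → Bool
  | [] => true
  | k :: ks => decide ((c.massOf k c.blocks : ℚ) ≤ c.g0 * (4 : ℚ) ^ c.kbits) && massOK ks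

/-- Sum of a list of rationals (structural). -/
def qsum : List ℚ → ℚ
  | [] => 0
  | q :: qs => q + qsum qs

/-- **The main (cheap) check**: header, window items, blocks and packing, positivity of `aden`, `nparts`,
`pcells`, the Kronecker capacity `rank·dmax² < W` and `Wr1 = W^(rank−1)`, the diagonal masses against `g0`, and
`g0 + Σ dparts ≤ D` with `dparts` of length `nparts`. [folklore] -/
def check : Bool :=
  c.logsOK && decide (c.window.length = c.wsq.length) && decide (c.window.length = c.woff.length) &&
    c.windowOK c.witems && c.blocksOK c.blocks && decide (c.rank * c.dmax * c.dmax < c.W) && decide (1 ≤ c.rank) &&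
    decide (c.Wr1 = c.W ^ (c.rank - 1)) && decide (0 < c.aden) && decide (0 < c.nparts) && decide (0 < c.pcells) &&
    decide (c.dparts.length = c.nparts) && decide (0 ≤ c.g0) && c.massOK (List.range c.pcells) &&
    decide (c.g0 + qsum c.dparts ≤ c.D)

end Cert

end KCell

end Summit.RiemannHypothesis.RiemannHypothesis.Theorems.WeilFormatC

/-! Build note (rh-explicit-weil-1 gen8, 2026-08-24): re-committed byte-identical above this line to obtain a hub olean for the
importers `WeilFormatCKCellDefs/Brackets/Packing/Cells/Table/Sound` (accepted 2026-08-23T20:34Z, never built; OPS-REQUESTS l.199–221). -/
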